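import Summits.PneNP.PneNP.Theses.WitnessForging
import Summits.PneNP.PneNP.Theorems.WitnessForgingCalibrationSatBPP

-- every `Summit.PneNP.PneNP.…` name repeats the summit = sub-problem component (layout D-0017)
set_option linter.dupNamespace false

/-!
# Reduction note (skeleton) for the piece `ShatteredForgingHard` (stmt-PneNP-2434) of the BC2
# redirect of `ForgingThesis` (stmt-PneNP-2430), route PneNP/WitnessForging

`ShatteredForgingHard` (∀ k ≥ k₀, ∀ α ∈ [5·2^k ln k/k, 2^{k-1}], ∀ PPT A:
`Pr_{Φ ∼ randomKCNF k n ⌊αn⌋}[Φ satisfiable ∧ A 1/4-forges μ_Φ] → 0`) is CONJECTURE-STRENGTH: its one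
known source of truth is the standard RANDOMIZED SEARCH-HARDNESS conjecture for random `k`-SAT above
the algorithmic barrier `κ*·2^k ln k/k` (Achlioptas–Coja-Oghlan 2008; Bresler–Huang 2021, κ* ≈ 4.911),
because a sampler is in particular a search algorithm. This file records that reduction, kernel-checked:

* `stub_searchHardRand` (the load-bearing stub, conjecture-strength): in the window, every PPT `A`
  outputs a satisfying assignment with probability `≥ 3/4` only on a vanishing fraction of formulas;
* `forger_solves` (PROVED, from `CalibrationSatBPP.ncard_div_self_eq_one`): a `1/4`-forger of a
  satisfiable `φ` outputs a satisfying assignment of `φ` with probability `≥ 3/4`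
  (`μ_φ(Sol φ) = 1`, so `|Pr[A ∈ Sol] − 1| ≤ 1/4`);
* `ShatteredForgingHard_of` (PROVED): monotonicity of the outer measure along
  `{Φ sat ∧ forged} ⊆ {Pr[A(Φ) ∈ Sol Φ] ≥ 3/4}` and a squeeze.

The substantive line for `stub_searchHardRand` is the TRANSFER of the sibling route
PneNP/OverlapGapAlgebra (ensemble m-OGP `NoStableSection`, PROVED there in the literal-array model at
`α_k = 5·2^k ln k/k`, + the open crux `SolvableImpliesStableSection`) to randomized algorithms and the
proper-clause model `randomKCNF` — to be planned on the crux chain of stmt-PneNP-2434, not here.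
-/

namespace Summit.PneNP.PneNP.Cruxes.ForgingThesis.SplitBirthShatteredForgingHard

open Literature.Computability.Complexity Filter Summit.PneNP.PneNP.Theses.WitnessForging

/-! ### The load-bearing stub -/

/-- **Stub (randomized search hardness of random `k`-SAT in the window; conjecture-strength).**
There is `k₀` such that for all `k ≥ k₀`, all `α` with `5·2^k ln k/k ≤ α ≤ 2^{k-1}` and every PPT
`A`, the set of formulas on which `A` outputs a satisfying assignment (bit string of length `numVars`)
with probability `≥ 3/4` has vanishing mass under `randomKCNF k n ⌊αn⌋`.
[cite: doi:10.1109/focs.2008.11 (algorithmic barrier)] [cite: doi:10.1109/focs52979.2021.00038, Thm 1.2, Conj.] -/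
theorem stub_searchHardRand : ∃ k₀ : ℕ, ∀ k ≥ k₀, ∀ α : ℝ, 5 * 2 ^ k * Real.log k / k ≤ α → 2 * α ≤ 2 ^ k →
    ∀ A : RandAlg (List Bool) (List Bool), A.IsPolyTime id id →
      Tendsto (fun n : ℕ => ((randomKCNF k n ⌊α * n⌋₊).toOuterMeasure
        {φ | (3 / 4 : ℝ) ≤ A.pr id (encodingCNF.encode φ)
          {y : List Bool | y.length = φ.numVars ∧ φ.eval (fun i => y.getD i false) = true}}).toReal)
        atTop (nhds 0) := by
  sorry

/-! ### A forger is a solver (proved) -/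

/-- **A `1/4`-forger of a satisfiable formula solves it with probability `≥ 3/4`**: `μ_φ(Sol φ) = 1`
(`CalibrationSatBPP.ncard_div_self_eq_one`), so `|Pr[A(enc φ) ∈ Sol φ] − 1| ≤ 1/4`. [folklore] -/
theorem forger_solves (A : RandAlg (List Bool) (List Bool)) (φ : CNF ℕ) (hsat : φ.Satisfiable)
    (hE : ∀ E : Set (List Bool), |A.pr id (encodingCNF.encode φ) E -
      (({y : List Bool | y.length = φ.numVars ∧ φ.eval (fun i => y.getD i false) = true} ∩ E).ncard : ℝ) /
        ({y : List Bool | y.length = φ.numVars ∧ φ.eval (fun i => y.getD i false) = true}.ncard : ℝ)| ≤ 1 / 4) :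
    (3 / 4 : ℝ) ≤ A.pr id (encodingCNF.encode φ)
      {y : List Bool | y.length = φ.numVars ∧ φ.eval (fun i => y.getD i false) = true} := by
  have h := hE {y : List Bool | y.length = φ.numVars ∧ φ.eval (fun i => y.getD i false) = true}
  rw [Summit.PneNP.PneNP.Theorems.CalibrationSatBPP.ncard_div_self_eq_one hsat] at h
  have := (abs_le.1 h).1
  linarith

/-! ### Composition -/

/-- A `PMF` gives every set mass at most `1`. [folklore] -/
theorem toOuterMeasure_apply_le_one {β : Type} (p : PMF β) (s : Set β) : p.toOuterMeasure s ≤ 1 := by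
  rw [PMF.toOuterMeasure_apply, ← p.tsum_coe]
  exact ENNReal.tsum_le_tsum fun x => Set.indicator_le_self s p x

/-- **`ShatteredForgingHard` from randomized search hardness**: the forged-and-satisfiable event is
contained in the solved-with-probability-`3/4` event (`forger_solves`), so its mass is squeezed to `0`.
[folklore] -/
theorem ShatteredForgingHard_of
    (h1 : ∃ k₀ : ℕ, ∀ k ≥ k₀, ∀ α : ℝ, 5 * 2 ^ k * Real.log k / k ≤ α → 2 * α ≤ 2 ^ k →
      ∀ A : RandAlg (List Bool) (List Bool), A.IsPolyTime id id →
        Tendsto (fun n : ℕ => ((randomKCNF k n ⌊α * n⌋₊).toOuterMeasure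
          {φ | (3 / 4 : ℝ) ≤ A.pr id (encodingCNF.encode φ)
            {y : List Bool | y.length = φ.numVars ∧ φ.eval (fun i => y.getD i false) = true}}).toReal)
          atTop (nhds 0)) :
    ShatteredForgingHard := by
  obtain ⟨k₀, hk₀⟩ := h1
  refine ⟨k₀, fun k hk α hα1 hα2 A hA => ?_⟩
  have hT := hk₀ k hk α hα1 hα2 A hA
  refine tendsto_of_tendsto_of_tendsto_of_le_of_le tendsto_const_nhds hT
    (fun n => ENNReal.toReal_nonneg) (fun n => ?_)
  refine ENNReal.toReal_mono ((toOuterMeasure_apply_le_one _ _).trans_lt ENNReal.one_lt_top).ne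
    (MeasureTheory.measure_mono fun φ hφ => ?_)
  exact forger_solves A φ hφ.1 hφ.2

end Summit.PneNP.PneNP.Cruxes.ForgingThesis.SplitBirthShatteredForgingHard
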